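import Summits.CriticalPhenomena.CardyFormulaZ2.Theorems.CardyUniqueLimitCardyRigidityFaceHalfPlaneG2OfTransfer
import Literature.Probability.RandomPlanarGeometry.ChordalCurveFamilyProofs
import HarnessLib

/-!
# Reading the crossing hypotheses of `PercFaceAnnulusTransfer` on the parametrised head (input (T3), continuum side)

Crux `Summit.CriticalPhenomena.CardyFormulaZ2.Theses.CardyUniqueLimit.CardyRigidity`
(stmt-CriticalPhenomena-0746), line `crossing_martingale`, stub A2‴ `stub_percFaceAnnulusTransfer :
Driver.PercFaceAnnulusTransfer` (`…FaceHalfPlaneG2OfTransfer.lean`).  Clause (T3) of that predicate is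
hypothesised on the CURVE CLASSES `stopAt F (headClass γ̂ u)` (its trace misses the open disc
`B(z₀, R)`) and `startFrom F (headClass γ̂ u) ∈ CurveClass.crossingIn z₀ r R univ` (SOME curve at
reparametrisation distance `0` from the future crosses `A(z₀, r, R)`), while the lattice arguments
(`…FaceAnnulusTransferSideChain.lean`) and the round annulus (`…FaceAnnulusTransferRoundAnnulus.lean`,
`RoundAnnulus.exists_crossing_window`) need PARAMETRISED statements about `γ̂` on `[0, u]`.  This file
does the reading, through the representative independence `CurveClass.stopAt_mk_holds` /
`startFrom_mk_holds` and an `ε`-close reparametrisation (`Curve.exists_dist_reparam_lt`):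

* `Window.head`, `Window.head_apply`, `Window.headClass_eq` — the head curve `s ↦ γ̂ (u s)`;
* `Window.le_dist_of_forall_notMem` — **the past is far**: if `γ̂[0, t]` misses `F` and `t ≤ u`, then
  `γ̂ t` lies on the trace of `stopAt F (headClass γ̂ u)`, hence (under the first hypothesis) at distance
  `≥ R` from `z₀`;
* `Window.exists_levels_of_crossingIn` — **the future passes two levels**: under the second hypothesis,
  for all `r < p ≤ q < R` there are times `ta, tb ≤ u` with `|γ̂ ta - z₀| ≤ p` and `q ≤ |γ̂ tb - z₀|`.

References: A. Kemppainen, S. Smirnov, Ann. Probab. 45 (2017), §2.1.3 (Condition G2), §2.2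
[KemppainenSmirnov2017]; M. Aizenman, A. Burchard, Duke Math. J. 99 (1999), §2.1 (the curve space)
[AizenmanBurchard1999].
(buildfix 2026-08-20: comment-only re-land to re-enqueue the module build after its blocking imports were repaired; no declaration changed.)
-/

noncomputable section

open Set Metric Filter Topology
open scoped NNReal unitInterval
open Literature.Probability.RandomPlanarGeometry

namespace Summit.CriticalPhenomena.CardyFormulaZ2.Cruxes.CardyRigidity.CrossingMartingale

namespace Window

/-! ### The head curve -/

/-- The head curve `s ↦ γ (u s)` of a path `γ : [0, ∞) → ℂ` (the representative behind
`Driver.headClass γ u`). [folklore] -/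
def head (γ : C(ℝ≥0, ℂ)) (u : ℝ≥0) : Curve ℂ :=
  ⟨γ.comp ⟨fun t : I ↦ u * Real.toNNReal (t : ℝ),
    continuous_const.mul (continuous_real_toNNReal.comp continuous_subtype_val)⟩⟩

/-- Pointwise formula. [folklore] -/
theorem head_apply (γ : C(ℝ≥0, ℂ)) (u : ℝ≥0) (s : I) : head γ u s = γ (u * Real.toNNReal (s : ℝ)) := rfl

/-- `Driver.headClass γ u` is the class of the head curve. [folklore] -/
theorem headClass_eq (γ : C(ℝ≥0, ℂ)) (u : ℝ≥0) : Driver.headClass γ u = CurveClass.mk (head γ u) := rfl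

/-- Every time `t ≤ u` is a head parameter: `t = u · (t/u)`. [folklore] -/
theorem exists_param_eq (γ : C(ℝ≥0, ℂ)) {u t : ℝ≥0} (hu : 0 < u) (ht : t ≤ u) :
    ∃ s : I, (s : ℝ) = t / u ∧ head γ u s = γ t := by
  have hs1 : ((t / u : ℝ≥0) : ℝ) ≤ 1 := by exact_mod_cast div_le_one_of_le₀ ht zero_le
  refine ⟨⟨((t / u : ℝ≥0) : ℝ), NNReal.coe_nonneg _, hs1⟩, by push_cast; rfl, ?_⟩
  rw [head_apply]
  change γ (u * Real.toNNReal ((t / u : ℝ≥0) : ℝ)) = γ t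
  rw [Real.toNNReal_coe, mul_div_cancel₀ _ hu.ne']

/-- Head parameters are times `≤ u`. [folklore] -/
theorem param_le (u : ℝ≥0) (s : I) : u * Real.toNNReal (s : ℝ) ≤ u :=
  mul_le_of_le_one_right zero_le ((Real.toNNReal_le_toNNReal s.2.2).trans_eq Real.toNNReal_one)

/-! ### The past is far -/

/-- If `γ[0, t]` misses `F` and `t ≤ u`, then `t / u` is at most the first hitting parameter of `F`
by the head curve. [folklore] -/
theorem div_le_hitParam {γ : C(ℝ≥0, ℂ)} {u t : ℝ≥0} (hu : 0 < u) (ht : t ≤ u) {F : Set ℂ}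
    (hF : IsClosed F) (hmiss : ∀ s : ℝ≥0, s ≤ t → γ s ∉ F) :
    (t : ℝ) / u ≤ (head γ u).hitParam F := by
  by_contra hlt
  push Not at hlt
  rcases Curve.hitParam_mem_hitSet hF (head γ u) with ⟨hI, hmem⟩ | h1
  · refine hmiss (u * Real.toNNReal ((head γ u).hitParam F)) ?_ hmem
    have h0 := ((head γ u).hitParam_mem_Icc F).1
    have : (u : ℝ) * (head γ u).hitParam F ≤ t := by
      rw [lt_div_iff₀ (by exact_mod_cast hu : (0 : ℝ) < u)] at hlt
      linarith
    rw [← NNReal.coe_le_coe, NNReal.coe_mul, Real.coe_toNNReal _ h0]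
    exact this
  · have hs1 : (t : ℝ) / u ≤ 1 := div_le_one_of_le₀ (by exact_mod_cast ht) (NNReal.coe_nonneg _)
    rw [mem_singleton_iff.1 h1] at hlt
    exact absurd hs1 (not_le.2 hlt)

/-- **The past is far.**  If the trace of `stopAt F (headClass γ u)` misses the open disc `B(z₀, R)`
(`F` closed), then every time `t ≤ u` with `γ[0, t] ∩ F = ∅` has `R ≤ |γ t - z₀|` (such `γ t` lie on
that trace). [cite: KemppainenSmirnov2017, §2.1.3] -/
theorem le_dist_of_forall_notMem {γ : C(ℝ≥0, ℂ)} {u t : ℝ≥0} (hu : 0 < u) (ht : t ≤ u) {F : Set ℂ}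
    (hF : IsClosed F) (hmiss : ∀ s : ℝ≥0, s ≤ t → γ s ∉ F) {z₀ : ℂ} {R : ℝ}
    (hA : Disjoint (CurveClass.stopAt F (Driver.headClass γ u)).range (ball z₀ R)) :
    R ≤ dist (γ t) z₀ := by
  rw [headClass_eq, CurveClass.stopAt_mk_holds F hF, CurveClass.range_mk] at hA
  obtain ⟨s, hs, hγs⟩ := exists_param_eq γ hu ht
  have hle : (s : ℝ) ≤ (head γ u).hitParam F := hs ▸ div_le_hitParam hu ht hF hmiss
  -- `γ t` is the point of parameter `s / τ` of the stopped head
  have hmem : γ t ∈ ((head γ u).stopAt F).range := by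
    set τ := (head γ u).hitParam F with hτ
    rcases eq_or_lt_of_le ((head γ u).hitParam_mem_Icc F).1 with h0 | hpos
    · -- `τ = 0`: then `s = 0` and `γ t` is the source
      have hs0 : (s : ℝ) = 0 := le_antisymm (hle.trans_eq h0.symm) s.2.1
      refine ⟨0, ?_⟩
      rw [Curve.stopAt_apply, ← hγs]
      congr 1
      apply Subtype.ext
      simp [hs0]
    · have hq : (s : ℝ) / τ ∈ Icc (0 : ℝ) 1 := ⟨div_nonneg s.2.1 hpos.le, (div_le_one hpos).2 hle⟩
      refine ⟨⟨(s : ℝ) / τ, hq⟩, ?_⟩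
      rw [Curve.stopAt_apply, ← hγs]
      congr 1
      apply Subtype.ext
      rw [coe_projIcc]
      simp only [hτ]
      rw [mul_div_cancel₀ _ hpos.ne', min_eq_right s.2.2, max_eq_right s.2.1]
  by_contra hlt
  push Not at hlt
  exact (Set.disjoint_left.1 hA) hmem (mem_ball.2 hlt)

/-! ### The future passes two levels -/

/-- A curve at reparametrisation distance `0` from `c` and a parameter `a`: some point of `c` is
`ε`-close to the point `γ' a`. [cite: AizenmanBurchard1999, §2.1] -/
theorem exists_dist_lt_of_mk_eq {γ' c : Curve ℂ} (h : CurveClass.mk γ' = CurveClass.mk c) (a : I)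
    {ε : ℝ} (hε : 0 < ε) : ∃ s : I, dist (γ' a) (c s) < ε := by
  have hd : dist γ' c < ε := by rw [CurveClass.mk_eq_mk_iff_dist_eq_zero.1 h]; exact hε
  obtain ⟨φ, hφ⟩ := Curve.exists_dist_reparam_lt hd
  exact ⟨φ a, (ContinuousMap.dist_apply_le_dist a).trans_lt hφ⟩

/-- **The future passes two levels.**  If `startFrom F (headClass γ u) ∈ CurveClass.crossingIn z₀ r R S`
(`F` closed), then for all levels `r < p` and `q < R` there are times `ta, tb ≤ u` with
`|γ ta - z₀| ≤ p` and `q ≤ |γ tb - z₀|` (a crossing curve at reparametrisation distance `0` from the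
future has points within `r` and beyond `R`; approximate them on the future).
[cite: KemppainenSmirnov2017, §2.1.3] -/
theorem exists_levels_of_crossingIn {γ : C(ℝ≥0, ℂ)} {u : ℝ≥0} {F : Set ℂ}
    (hF : IsClosed F) {z₀ : ℂ} {r R p q : ℝ} (hp : r < p) (hq : q < R) {S : Set ℂ}
    (hB : (Driver.headClass γ u).startFrom F ∈ CurveClass.crossingIn z₀ r R S) :
    ∃ ta tb : ℝ≥0, ta ≤ u ∧ tb ≤ u ∧ dist (γ ta) z₀ ≤ p ∧ q ≤ dist (γ tb) z₀ := by
  rw [headClass_eq, CurveClass.startFrom_mk_holds F hF] at hB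
  obtain ⟨γ', hγ', a, b, -, hends, -⟩ := hB
  set c := (head γ u).startFrom F with hc
  set ε := min (p - r) (R - q) with hε
  have hεpos : 0 < ε := lt_min (by linarith) (by linarith)
  -- the two end points of the crossing, approximated on the future
  have key : ∀ a' : I, (dist (γ' a') z₀ ≤ r → ∃ t : ℝ≥0, t ≤ u ∧ dist (γ t) z₀ ≤ p) ∧
      (R ≤ dist (γ' a') z₀ → ∃ t : ℝ≥0, t ≤ u ∧ q ≤ dist (γ t) z₀) := by
    intro a'
    obtain ⟨s, hs⟩ := exists_dist_lt_of_mk_eq hγ' a' hεpos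
    set s' : I := projIcc 0 1 zero_le_one ((head γ u).hitParam F + (1 - (head γ u).hitParam F) * s)
      with hs'
    have hcs : c s = γ (u * Real.toNNReal (s' : ℝ)) := by
      rw [hc, Curve.startFrom_apply]; rfl
    refine ⟨fun hr ↦ ⟨u * Real.toNNReal (s' : ℝ), param_le u s', ?_⟩,
      fun hR ↦ ⟨u * Real.toNNReal (s' : ℝ), param_le u s', ?_⟩⟩
    · rw [← hcs]
      have h1 := dist_triangle (c s) (γ' a') z₀
      rw [dist_comm (c s) (γ' a')] at h1
      have hε1 : ε ≤ p - r := min_le_left _ _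
      linarith
    · rw [← hcs]
      have h1 := dist_triangle (γ' a') (c s) z₀
      have hε2 : ε ≤ R - q := min_le_right _ _
      linarith
  rcases hends with ⟨ha, hb⟩ | ⟨ha, hb⟩
  · obtain ⟨ta, hta, hda⟩ := (key a).1 ha
    obtain ⟨tb, htb, hdb⟩ := (key b).2 hb
    exact ⟨ta, tb, hta, htb, hda, hdb⟩
  · obtain ⟨tb, htb, hdb⟩ := (key a).2 ha
    obtain ⟨ta, hta, hda⟩ := (key b).1 hb
    exact ⟨ta, tb, hta, htb, hda, hdb⟩

end Window

/-- **Registered form** (anchor `window_le_dist_of_forall_notMem` of stmt-CriticalPhenomena-0746, input (T3) of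
`Driver.PercFaceAnnulusTransfer`): under the past hypothesis of (T3), times before `F` and before `u` are far from `z₀`.
[cite: KemppainenSmirnov2017, §2.1.3] -/
theorem window_le_dist_of_forall_notMem : ∀ {γ : ContinuousMap NNReal ℂ} {u t : NNReal}, 0 < u → t ≤ u → ∀ {F : Set ℂ}, IsClosed F → (∀ s : NNReal, s ≤ t → γ s ∉ F) → ∀ {z₀ : ℂ} {R : ℝ}, Disjoint (Literature.Probability.RandomPlanarGeometry.CurveClass.stopAt F (Driver.headClass γ u)).range (Metric.ball z₀ R) → R ≤ dist (γ t) z₀ :=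
  fun hu ht _ hF hmiss _ _ hA ↦ Window.le_dist_of_forall_notMem hu ht hF hmiss hA

/-- **Registered form** (anchor `window_exists_levels_of_crossingIn` of stmt-CriticalPhenomena-0746, input (T3) of
`Driver.PercFaceAnnulusTransfer`): under the future hypothesis of (T3), the path passes below any level `p > r` and
above any level `q < R` before time `u`. [cite: KemppainenSmirnov2017, §2.1.3] -/
theorem window_exists_levels_of_crossingIn : ∀ {γ : ContinuousMap NNReal ℂ} {u : NNReal} {F : Set ℂ}, IsClosed F → ∀ {z₀ : ℂ} {r R p q : ℝ}, r < p → q < R → ∀ {S : Set ℂ}, (Driver.headClass γ u).startFrom F ∈ Literature.Probability.RandomPlanarGeometry.CurveClass.crossingIn z₀ r R S → ∃ ta tb : NNReal, ta ≤ u ∧ tb ≤ u ∧ dist (γ ta) z₀ ≤ p ∧ q ≤ dist (γ tb) z₀ :=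
  fun hF _ _ _ _ _ hp hq _ hB ↦ Window.exists_levels_of_crossingIn hF hp hq hB

end Summit.CriticalPhenomena.CardyFormulaZ2.Cruxes.CardyRigidity.CrossingMartingale

end
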